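import Literature.NumberTheory.Sieve.CFSemigroupTwistedResolvent
import Literature.NumberTheory.Sieve.CFSemigroupAperiodic
import Literature.NumberTheory.Sieve.CFSemigroupEigenfunctionUnique
import HarnessLib

/-!
# Unimodular eigenfamilies of the congruence transfer operator: modulus and phase

Support file (all results proved) for the named fact
`Literature.NumberTheory.Sieve.MageeOhWinter2019_uniformCounting` (`CFSemigroupCounting.lean`).
First half of the proof that, for FIXED `q` prime to `6 (b - a)` and real `t ≠ 0`, the congruence
transfer operator `𝓜_{δ+it,q}` of [MageeOhWinter2019, §3.2] has no eigenvalue of modulus one on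
`SL₂(ℤ/qℤ) → CfLip` (the vector version of the aperiodicity argument of
`CFSemigroupAperiodic.lean`, [MageeOhWinter2019, §4.1–4.2]; there it is the ingredient of
Thm. 4 that does not need expansion). Let `𝓜_{δ+it} F = ω F`, `|ω| = 1`.

* `cfAbsFam_le_cfTwistSumR`: the modulus family `Φ_ξ = |F_ξ|` is sub-invariant, `Φ ≤ T_1 Φ`;
* `cfTwist_eigen_maxPrinciple`: **maximum principle for families**: with
  `m = max_{ξ,x} |F_ξ(x)|/h(x)`, `|F_ξ| ≤ m h` on `[0,1]` and `|F_ξ| = m h` on the Cantor set `E_A`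
  for EVERY fibre `ξ` (vanishing of `m h - |F|` propagates along twist-words; primitivity of the
  twists and density of backward orbits in `E_A` reach every fibre and every point);
* `cfTwist_eigen_phase`, `cfTwist_eigen_phase_path`: **phase alignment** across fibres along
  twist-word paths, and `cfTwist_eigen_phase_periodic`: at a periodic point `x_w` of a path `w`
  returning to its fibre (`σ_w = 1`), the unitary path weight equals `ω^{|w|}`.
  [cite: MageeOhWinter2019, §4.2]

## References

* M. Magee, H. Oh, D. Winter, J. reine angew. Math. 753 (2019) 89–135, §3.2, §4.1–4.2. [MageeOhWinter2019]
* F. Naud, Ann. Sci. ENS 38 (2005) 116–153, p. 132 (the convexity argument).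
-/

noncomputable section

open Set Filter Topology
open scoped MatrixGroups

namespace Literature.NumberTheory.Sieve

variable {A : Finset ℕ}

section Phase

variable (A) (hA : ∀ a ∈ A, 1 ≤ a) (h2 : 2 ≤ A.card) (q : ℕ)
include hA

/-! ### The modulus family -/

omit hA in
/-- The modulus family `Φ_ξ(y) = |F_ξ(y)|` of a family of Lipschitz functions. [folklore] -/
def cfAbsFam (F : SL(2, ZMod q) → CfLip) : SL(2, ZMod q) → ℝ → ℝ := fun ξ y => ‖(F ξ).extend y‖

omit hA in
/-- The modulus family is non-negative, bounded by `‖F‖`, `‖F‖`-Lipschitz and continuous. [folklore] -/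
theorem cfAbsFam_props [NeZero q] (F : SL(2, ZMod q) → CfLip) :
    (∀ η y, 0 ≤ cfAbsFam q F η y) ∧ (∀ η, ∀ y ∈ Icc (0 : ℝ) 1, |cfAbsFam q F η y| ≤ ‖F‖) ∧
      (∀ η, ∀ x ∈ Icc (0 : ℝ) 1, ∀ y ∈ Icc (0 : ℝ) 1, |cfAbsFam q F η x - cfAbsFam q F η y| ≤ ‖F‖ * |x - y|) ∧
      (∀ η, Continuous (cfAbsFam q F η)) := by
  refine ⟨fun η y => norm_nonneg _, fun η y _ => ?_, fun η x hx y hy => ?_, fun η => ?_⟩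
  · rw [cfAbsFam, abs_of_nonneg (norm_nonneg _)]
    exact ((F η).norm_extend_le y).trans (norm_le_pi_norm F η)
  · exact (abs_norm_sub_norm_le _ _).trans (((F η).norm_extend_sub_le hx hy).trans
      (mul_le_mul_of_nonneg_right (norm_le_pi_norm F η) (abs_nonneg _)))
  · exact ((F η).continuous.comp continuous_projIcc).norm

omit hA in
/-- **Monotonicity of the real twisted sums** on families ordered on `[0,1]`. [folklore] -/
theorem cfTwistSumR_mono (hA' : ∀ a ∈ A, 1 ≤ a) {Φ Ψ : SL(2, ZMod q) → ℝ → ℝ}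
    (h : ∀ η, ∀ y ∈ Icc (0 : ℝ) 1, Φ η y ≤ Ψ η y) :
    ∀ (n : ℕ) (ξ : SL(2, ZMod q)) {x : ℝ}, x ∈ Icc (0 : ℝ) 1 → cfTwistSumR A q n Φ ξ x ≤ cfTwistSumR A q n Ψ ξ x
  | 0, ξ, x, hx => h ξ x hx
  | n + 1, ξ, x, hx => by
      simp only [cfTwistSumR]
      exact Finset.sum_le_sum fun a _ => Finset.sum_le_sum fun b _ =>
        mul_le_mul_of_nonneg_left (cfTwistSumR_mono hA' h n _ (cfMoeb_pair_mem (hA' a a.2) (hA' b b.2) hx))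
          (cfWtR_nonneg A _ _ _)

omit hA in
/-- The modulus of the complex pair weight at `δ + it` is the real pair weight. [folklore] -/
theorem norm_cfWt_pair (t : ℝ) {a b : ℕ} (ha : 1 ≤ a) (hb : 1 ≤ b) {x : ℝ} (hx : x ∈ Icc (0 : ℝ) 1) :
    ‖cfWt ((cfDimension A : ℂ) + t * Complex.I) (cfGen a * cfGen b) x‖ = cfWtR A a b x := by
  have hd := (cfDenom_pair_bounds ha hb hx).1
  rw [norm_cfWt _ _ (by linarith), re_delta_add, cfWtR]

/-- **Sub-invariance of the modulus family:** if `𝓜_{δ+it} F = ω F` with `|ω| = 1` then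
`|F_ξ(x)| ≤ (T_1 |F|)_ξ(x)` on `[0,1]`. [cite: MageeOhWinter2019, §4.2] -/
theorem cfAbsFam_le_cfTwistSumR {t : ℝ} {ω : ℂ} (hω : ‖ω‖ = 1) {F : SL(2, ZMod q) → CfLip}
    (heig : cfTwist A hA q ((cfDimension A : ℂ) + t * Complex.I) F = ω • F)
    (ξ : SL(2, ZMod q)) {x : ℝ} (hx : x ∈ Icc (0 : ℝ) 1) :
    cfAbsFam q F ξ x ≤ cfTwistSumR A q 1 (cfAbsFam q F) ξ x := by
  have h := congrArg (fun G : SL(2, ZMod q) → CfLip => G ξ ⟨x, hx⟩) heig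
  simp only [cfTwist_apply, Pi.smul_apply, CfLip.smul_apply, CfLip.finset_sum_apply] at h
  have hnorm : cfAbsFam q F ξ x = ‖∑ a ∈ A.attach, ∑ b ∈ A.attach,
      cfPairOp (hA a a.2) (hA b b.2) ((cfDimension A : ℂ) + t * Complex.I) (F (ξ * cfSigma q a b)) ⟨x, hx⟩‖ := by
    rw [cfAbsFam, CfLip.extend_of_mem _ hx, h, norm_mul, hω, one_mul]
  rw [hnorm]
  simp only [cfTwistSumR, cfPairOp_apply]
  refine (norm_sum_le _ _).trans (Finset.sum_le_sum fun a _ => (norm_sum_le _ _).trans (Finset.sum_le_sum fun b _ => ?_))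
  rw [norm_mul, norm_cfWt_pair A t (hA a a.2) (hA b b.2) hx]
  rfl

/-- Iterated sub-invariance: `|F| ≤ T_n |F|` on `[0,1]`. [cite: MageeOhWinter2019, §4.2] -/
theorem cfAbsFam_le_cfTwistSumR_pow {t : ℝ} {ω : ℂ} (hω : ‖ω‖ = 1) {F : SL(2, ZMod q) → CfLip}
    (heig : cfTwist A hA q ((cfDimension A : ℂ) + t * Complex.I) F = ω • F) :
    ∀ (n : ℕ) (ξ : SL(2, ZMod q)) {x : ℝ}, x ∈ Icc (0 : ℝ) 1 → cfAbsFam q F ξ x ≤ cfTwistSumR A q n (cfAbsFam q F) ξ x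
  | 0, ξ, x, _ => le_rfl
  | n + 1, ξ, x, hx => by
      rw [cfTwistSumR_add A q n 1]
      exact (cfAbsFam_le_cfTwistSumR_pow hω heig n ξ hx).trans
        (cfTwistSumR_mono A q hA (fun η y hy => cfAbsFam_le_cfTwistSumR A hA q hω heig η hy) n ξ hx)

/-! ### Digit sequences as pair paths -/

omit hA in
/-- The first `2k` digits of `d` as a pair path (innermost pair first):
`pairsRev d (k+1) = (d_{2k}, d_{2k+1}) :: pairsRev d k`. [folklore] -/
def cfPairsRev (d : ℕ → ℕ) (hd : ∀ i, d i ∈ A) : ℕ → List (A × A)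
  | 0 => []
  | k + 1 => (⟨d (2 * k), hd _⟩, ⟨d (2 * k + 1), hd _⟩) :: cfPairsRev d hd k

omit hA in
/-- The pair path has length `k`. [folklore] -/
theorem length_cfPairsRev (d : ℕ → ℕ) (hd : ∀ i, d i ∈ A) : ∀ k, (cfPairsRev A d hd k).length = k
  | 0 => rfl
  | k + 1 => by simp only [cfPairsRev, List.length_cons, length_cfPairsRev d hd k]

/-- **The pair path realises the word:** `pt_{pairsRev d k}(z) = M_{2k}(d) z` on `[0,1]`. [folklore] -/
theorem cfPathPoint_cfPairsRev (d : ℕ → ℕ) (hd : ∀ i, d i ∈ A) :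
    ∀ (k : ℕ) {z : ℝ}, z ∈ Icc (0 : ℝ) 1 → cfPathPoint A (cfPairsRev A d hd k) z = cfMoeb (cfWord d (2 * k)) z
  | 0, z, _ => by show z = cfMoeb (cfWord d 0) z; simp [cfMoeb]
  | k + 1, z, hz => by
      have hd1 : ∀ i, 1 ≤ d i := fun i => hA _ (hd i)
      simp only [cfPairsRev, cfPathPoint]
      rw [cfPathPoint_cfPairsRev d hd k (cfMoeb_pair_mem (hd1 _) (hd1 _) hz),
        show 2 * (k + 1) = (2 * k + 1) + 1 by ring, cfWord_succ, cfWord_succ, mul_assoc]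
      have hy := cfMoeb_pair_mem (hd1 (2 * k)) (hd1 (2 * k + 1)) hz
      have hden : cfDenom (cfGen (d (2 * k)) * cfGen (d (2 * k + 1))) z ≠ 0 :=
        ne_of_gt (by linarith [(cfDenom_pair_bounds (hd1 (2 * k)) (hd1 (2 * k + 1)) hz).1])
      have hmat : cfMat (fun i : Fin (2 * k) => d i) = cfWord d (2 * k) :=
        cfWord_congr fun i hi => by rw [cfExt_of_lt _ hi]
      have hden2 : cfDenom (cfWord d (2 * k)) (cfMoeb (cfGen (d (2 * k)) * cfGen (d (2 * k + 1))) z) ≠ 0 := by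
        rw [← hmat]; exact (cfDenom_cfMat_pos (fun i => hd1 i) hy).ne'
      rw [cfMoeb_mul _ _ hden hden2]

/-! ### The maximum principle for families -/

include h2 in
/-- **Maximum principle for unimodular eigenfamilies of the congruence operator:** if the twists are
primitive, `𝓜_{δ+it} F = ω F` with `|ω| = 1`, then with `m = max |F_ξ(x)|/h(x)` one has
`|F_ξ| ≤ m h` on `[0,1]` and `|F_ξ| = m h` on the Cantor set `E_A`, for every fibre `ξ`.
[cite: MageeOhWinter2019, §4.2] -/
theorem cfTwist_eigen_maxPrinciple [NeZero q] {n₀ : ℕ}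
    (hprim : ∀ n ≥ n₀, ∀ ξ η : SL(2, ZMod q), ∃ w : List (A × A), w.length = n ∧ ξ * cfSigmaWord A q w = η)
    {t : ℝ} {ω : ℂ} (hω : ‖ω‖ = 1) {F : SL(2, ZMod q) → CfLip}
    (heig : cfTwist A hA q ((cfDimension A : ℂ) + t * Complex.I) F = ω • F) :
    ∃ m : ℝ, 0 ≤ m ∧ (∀ ξ, ∀ x ∈ Icc (0 : ℝ) 1, cfAbsFam q F ξ x ≤ m * cfHδ A hA h2 x) ∧
      ∀ ξ, ∀ x ∈ cfCantorSet A, cfAbsFam q F ξ x = m * cfHδ A hA h2 x := by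
  obtain ⟨hΦ0, -, -, hΦcont⟩ := cfAbsFam_props q F
  set Φ := cfAbsFam q F with hΦ
  set h := cfHδ A hA h2 with hh
  have hpos : ∀ x ∈ Icc (0 : ℝ) 1, 0 < h x := fun x hx => cfHδ_pos A hA h2 hx
  have hhcont : ContinuousOn h (Icc 0 1) := (cfHδ_cone A hA h2).continuousOn (by
    have := (cfDimension_pos hA h2).le; positivity)
  -- the maximum of `Φ_ξ(x)/h(x)` over `ξ` and `x`
  have hratio : ∀ ξ, ContinuousOn (fun x => Φ ξ x / h x) (Icc 0 1) := fun ξ =>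
    (hΦcont ξ).continuousOn.div hhcont fun x hx => (hpos x hx).ne'
  have hex : ∀ ξ, ∃ x₀ ∈ Icc (0 : ℝ) 1, IsMaxOn (fun x => Φ ξ x / h x) (Icc 0 1) x₀ := fun ξ =>
    isCompact_Icc.exists_isMaxOn (nonempty_Icc.2 zero_le_one) (hratio ξ)
  choose xm hxmI hxm using hex
  obtain ⟨ξ₀, -, hξ₀⟩ := Finset.exists_max_image Finset.univ (fun ξ => Φ ξ (xm ξ) / h (xm ξ)) Finset.univ_nonempty
  set x₀ := xm ξ₀ with hx₀def
  have hx₀ : x₀ ∈ Icc (0 : ℝ) 1 := hxmI ξ₀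
  set m : ℝ := Φ ξ₀ x₀ / h x₀ with hm
  have hm0 : 0 ≤ m := div_nonneg (hΦ0 _ _) (hpos x₀ hx₀).le
  have hle : ∀ ξ, ∀ x ∈ Icc (0 : ℝ) 1, Φ ξ x ≤ m * h x := by
    intro ξ x hx
    have h1 : Φ ξ x / h x ≤ Φ ξ (xm ξ) / h (xm ξ) := isMaxOn_iff.1 (hxm ξ) x hx
    have h2' : Φ ξ (xm ξ) / h (xm ξ) ≤ m := hξ₀ ξ (Finset.mem_univ ξ)
    have := h1.trans h2'
    rwa [div_le_iff₀ (hpos x hx)] at this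
  refine ⟨m, hm0, hle, ?_⟩
  have h5 : m * h x₀ = Φ ξ₀ x₀ := by rw [hm, div_mul_cancel₀ _ (hpos x₀ hx₀).ne']
  -- `g = m h ⊗ 𝟙 - Φ ≥ 0` and `(T_n g)_{ξ₀}(x₀) = 0`
  set g : SL(2, ZMod q) → ℝ → ℝ := fun ξ y => m * h y - Φ ξ y with hg
  have hg0 : ∀ ξ, ∀ y ∈ Icc (0 : ℝ) 1, 0 ≤ g ξ y := fun ξ y hy => by simp only [hg]; linarith [hle ξ y hy]
  have hTg : ∀ n, cfTwistSumR A q n g ξ₀ x₀ = 0 := by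
    intro n
    have hsplit : g = fun ξ y => (fun (_ : SL(2, ZMod q)) y => m * h y) ξ y + (-1) * Φ ξ y := by
      funext ξ y; simp only [hg]; ring
    have h1 : cfTwistSumR A q n g ξ₀ x₀ = m * h x₀ - cfTwistSumR A q n Φ ξ₀ x₀ := by
      rw [hsplit, cfTwistSumR_add_smul, cfTwistSumR_const_mul, cfTwistSumR_cfHδ A hA h2 q n ξ₀ hx₀]; ring
    have h3 : 0 ≤ cfTwistSumR A q n g ξ₀ x₀ := cfTwistSumR_nonneg A hA q hg0 n ξ₀ hx₀
    have h4 := cfAbsFam_le_cfTwistSumR_pow A hA q hω heig n ξ₀ hx₀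
    have h7 : cfTwistSumR A q n g ξ₀ x₀ ≤ 0 := by rw [h1, h5]; linarith
    linarith
  -- every path from `(ξ₀, x₀)`: `g_{ξ₀ σ_w}(pt_w x₀) = 0`
  have hpath : ∀ w : List (A × A), g (ξ₀ * cfSigmaWord A q w) (cfPathPoint A w x₀) = 0 := by
    intro w
    have h1 := cfTwistSumR_ge_path A hA q hg0 w ξ₀ hx₀
    rw [hTg] at h1
    have hwt : 0 < cfPathWt A w x₀ :=
      lt_of_lt_of_le (pow_pos (Real.rpow_pos_of_pos (by positivity) _) _)
        (le_cfPathWt A hA h2 (B := A.sup id) (fun c hc => Finset.le_sup (f := id) hc) w hx₀)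
    have hge := hg0 (ξ₀ * cfSigmaWord A q w) _ (cfPathPoint_mem A hA w hx₀)
    nlinarith
  -- pass to the Cantor set in every fibre
  intro η e he
  obtain ⟨d, hdA, rfl⟩ := he
  have hd : ∀ i, 1 ≤ d i := fun i => hA _ (hdA i)
  have hgcont : ∀ ξ, ContinuousOn (g ξ) (Icc 0 1) := fun ξ => by
    simp only [hg]; exact (continuousOn_const.mul hhcont).sub (hΦcont ξ).continuousOn
  -- connectors: for each `k`, a word `c_k` of length `n₀` with `ξ₀ σ_{c_k} σ_{pairsRev d k} = η`
  have hconn : ∀ k, ∃ c : List (A × A), ξ₀ * cfSigmaWord A q (c ++ cfPairsRev A d hdA k) = η := by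
    intro k
    obtain ⟨c, -, hc⟩ := hprim n₀ le_rfl ξ₀ (η * (cfSigmaWord A q (cfPairsRev A d hdA k))⁻¹)
    exact ⟨c, by rw [cfSigmaWord_append, ← mul_assoc, hc, inv_mul_cancel_right]⟩
  choose c hc using hconn
  set z : ℕ → ℝ := fun k => cfPathPoint A (c k) x₀ with hz
  have hzI : ∀ k, z k ∈ Icc (0 : ℝ) 1 := fun k => cfPathPoint_mem A hA (c k) hx₀
  have hy : ∀ k, cfPathPoint A (c k ++ cfPairsRev A d hdA k) x₀ = cfMoeb (cfWord d (2 * k)) (z k) := by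
    intro k
    have happ : ∀ (l₁ l₂ : List (A × A)) (x : ℝ), cfPathPoint A (l₁ ++ l₂) x = cfPathPoint A l₂ (cfPathPoint A l₁ x) := by
      intro l₁ l₂
      induction l₁ with
      | nil => intro x; rfl
      | cons p l ih => intro x; exact ih _
    rw [happ, cfPathPoint_cfPairsRev A hA d hdA k (hzI k)]
  have hy0 : ∀ k, g η (cfMoeb (cfWord d (2 * k)) (z k)) = 0 := fun k => by
    have := hpath (c k ++ cfPairsRev A d hdA k)
    rwa [hc k, hy k] at this
  have hyI : ∀ k, cfMoeb (cfWord d (2 * k)) (z k) ∈ Icc (0 : ℝ) 1 := fun k => by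
    rw [← hy k]; exact cfPathPoint_mem A hA _ hx₀
  have hylim : Tendsto (fun k => cfMoeb (cfWord d (2 * k)) (z k)) atTop (𝓝 (cfValue d)) := by
    have hb : ∀ k, |cfMoeb (cfWord d (2 * k)) (z k) - cfValue d| ≤ 4 * (1 / 2 : ℝ) ^ (2 * k) := fun k =>
      (abs_cfMoeb_sub_cfValue_le hd (2 * k) (hzI k)).trans (two_div_cfDen_sq_le hA hd (2 * k))
    have h0 : Tendsto (fun k : ℕ => 4 * (1 / 2 : ℝ) ^ (2 * k)) atTop (𝓝 0) := by
      have h1 : Tendsto (fun k : ℕ => 4 * (1 / 2 : ℝ) ^ k) atTop (𝓝 0) := by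
        have := (tendsto_pow_atTop_nhds_zero_of_lt_one (by norm_num : (0 : ℝ) ≤ 1 / 2) (by norm_num)).const_mul (4 : ℝ)
        simpa using this
      exact h1.comp (tendsto_id.const_mul_atTop' two_pos)
    rw [tendsto_iff_norm_sub_tendsto_zero]
    exact squeeze_zero (fun k => norm_nonneg _) (fun k => by rw [Real.norm_eq_abs]; exact hb k) h0
  have hcv : cfValue d ∈ Icc (0 : ℝ) 1 := cfValue_mem_Icc hd
  have hglim : Tendsto (fun k => g η (cfMoeb (cfWord d (2 * k)) (z k))) atTop (𝓝 (g η (cfValue d))) :=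
    ((hgcont η) (cfValue d) hcv).tendsto.comp
      (tendsto_nhdsWithin_of_tendsto_nhds_of_eventually_within _ hylim (Eventually.of_forall hyI))
  have hg_e : g η (cfValue d) = 0 := by
    have hz' : Tendsto (fun k => g η (cfMoeb (cfWord d (2 * k)) (z k))) atTop (𝓝 0) := by
      simp_rw [hy0]; exact tendsto_const_nhds
    exact tendsto_nhds_unique hglim hz'
  simp only [hg] at hg_e
  linarith

/-! ### Phase alignment across fibres -/

omit hA in
/-- Pair branches preserve the Cantor set. [folklore] -/
theorem cfMoeb_pair_mem_cfCantorSet (hA' : ∀ a ∈ A, 1 ≤ a) {a b : ℕ} (ha : a ∈ A) (hb : b ∈ A) {x : ℝ}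
    (hx : x ∈ cfCantorSet A) : cfMoeb (cfGen a * cfGen b) x ∈ cfCantorSet A := by
  have hxI := cfCantorSet_subset_Icc hA' hx
  have hb1 : (1 : ℝ) ≤ b := by exact_mod_cast hA' b hb
  have hxb : cfDenom (cfGen b) x ≠ 0 := by rw [cfDenom_cfGen]; linarith [hxI.1]
  have hy := one_div_add_mem_cfCantorSet hA' hx hb
  have hyI := cfCantorSet_subset_Icc hA' hy
  have ha1 : (1 : ℝ) ≤ a := by exact_mod_cast hA' a ha
  rw [cfMoeb_mul _ _ hxb (by rw [cfDenom_cfGen, cfMoeb_cfGen]; linarith [hyI.1]), cfMoeb_cfGen, cfMoeb_cfGen]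
  exact one_div_add_mem_cfCantorSet hA' hy ha

omit hA in
/-- `A.attach`-double sums are sums over `A × A` (any additive commutative monoid). [folklore] -/
theorem sum_attach_attach_eq_sum_prod' {M : Type*} [AddCommMonoid M] (f : A → A → M) :
    ∑ a ∈ A.attach, ∑ b ∈ A.attach, f a b = ∑ p : A × A, f p.1 p.2 := by
  rw [← Finset.univ_eq_attach, ← Finset.sum_product']
  rfl

/-- **The unitary path weight** `wt_{it}` along a twist-word path (first pair first). [folklore] -/
def cfPathWtI (t : ℝ) : List (A × A) → ℝ → ℂ
  | [], _ => 1
  | p :: w, x => cfWt (t * Complex.I) (cfGen ((p.1 : A) : ℕ) * cfGen ((p.2 : A) : ℕ)) x *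
      cfPathWtI t w (cfMoeb (cfGen ((p.1 : A) : ℕ) * cfGen ((p.2 : A) : ℕ)) x)

omit hA in
/-- Path points stay in the Cantor set. [folklore] -/
theorem cfPathPoint_mem_cfCantorSet (hA' : ∀ a ∈ A, 1 ≤ a) :
    ∀ (w : List (A × A)) {x : ℝ}, x ∈ cfCantorSet A → cfPathPoint A w x ∈ cfCantorSet A
  | [], _, hx => hx
  | p :: w, _, hx => cfPathPoint_mem_cfCantorSet hA' w (cfMoeb_pair_mem_cfCantorSet A hA' p.1.2 p.2.2 hx)

/-! ### Powers of returning paths -/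

omit hA in
/-- Path points of concatenations. [folklore] -/
theorem cfPathPoint_append : ∀ (u v : List (A × A)) (x : ℝ), cfPathPoint A (u ++ v) x = cfPathPoint A v (cfPathPoint A u x)
  | [], _, _ => rfl
  | _ :: u, v, _ => cfPathPoint_append u v _

omit hA in
/-- Unitary path weights of concatenations. [folklore] -/
theorem cfPathWtI_append (t : ℝ) : ∀ (u v : List (A × A)) (x : ℝ),
    cfPathWtI A t (u ++ v) x = cfPathWtI A t u x * cfPathWtI A t v (cfPathPoint A u x)
  | [], _, _ => by simp [cfPathWtI, cfPathPoint]
  | p :: u, v, x => by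
      rw [List.cons_append, cfPathWtI, cfPathWtI, cfPathPoint, cfPathWtI_append t u v, mul_assoc]

omit hA in
/-- **Powers of a returning path at its periodic point:** `pt_{wᵐ} x = x` and `wt_{it,wᵐ}(x) = wt_{it,w}(x)ᵐ`.
[folklore] -/
theorem cfPathWtI_replicate (t : ℝ) (w : List (A × A)) {x : ℝ} (hfix : cfPathPoint A w x = x) :
    ∀ m : ℕ, cfPathPoint A (List.replicate m w).flatten x = x ∧
      cfPathWtI A t (List.replicate m w).flatten x = cfPathWtI A t w x ^ m
  | 0 => by simp [cfPathPoint, cfPathWtI]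
  | m + 1 => by
      obtain ⟨h1, h3⟩ := cfPathWtI_replicate t w hfix m
      rw [List.replicate_succ, List.flatten_cons, cfPathPoint_append, hfix, cfPathWtI_append, hfix, h3, pow_succ']
      exact ⟨h1, rfl⟩

section Align

variable {q} [NeZero q] {t : ℝ} {ω : ℂ} (hω : ‖ω‖ = 1) {F : SL(2, ZMod q) → CfLip}
  (heig : cfTwist A hA q ((cfDimension A : ℂ) + t * Complex.I) F = ω • F)
  {m : ℝ} (hm : 0 < m) (hE : ∀ ξ, ∀ x ∈ cfCantorSet A, cfAbsFam q F ξ x = m * cfHδ A hA h2 x)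
include hω heig hm hE

include h2 in
omit hm [NeZero q] in
/-- **Phase alignment across fibres** (equality case of the triangle inequality, on the Cantor set):
`wt_{it}(g_a g_b, x) · F_{ξσ_{ab}}(g_a g_b x) · |F_ξ(x)| = ω · F_ξ(x) · |F_{ξσ_{ab}}(g_a g_b x)|`.
[cite: MageeOhWinter2019, §4.2] -/
theorem cfTwist_eigen_phase {x : ℝ} (hx : x ∈ cfCantorSet A) (ξ : SL(2, ZMod q)) {a b : ℕ} (ha : a ∈ A) (hb : b ∈ A) :
    cfWt (t * Complex.I) (cfGen a * cfGen b) x * (F (ξ * cfSigma q a b)).extend (cfMoeb (cfGen a * cfGen b) x) *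
        ((cfAbsFam q F ξ x : ℝ) : ℂ) =
      ω * (F ξ).extend x * ((cfAbsFam q F (ξ * cfSigma q a b) (cfMoeb (cfGen a * cfGen b) x) : ℝ) : ℂ) := by
  have hxI : x ∈ Icc (0 : ℝ) 1 := cfCantorSet_subset_Icc hA hx
  have hδ := (cfDimension_pos hA h2).le
  set s : ℂ := (cfDimension A : ℂ) + t * Complex.I with hs
  have hre : s.re = cfDimension A := re_delta_add A t
  -- the terms of the eigen-equation at `(ξ, x)`
  set z : A × A → ℂ := fun p =>
    cfWt s (cfGen (p.1 : ℕ) * cfGen (p.2 : ℕ)) x *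
      (F (ξ * cfSigma q (p.1 : ℕ) (p.2 : ℕ))).extend (cfMoeb (cfGen (p.1 : ℕ) * cfGen (p.2 : ℕ)) x) with hz
  have hS : ∑ p : A × A, z p = ω * (F ξ).extend x := by
    have h := congrArg (fun G : SL(2, ZMod q) → CfLip => G ξ ⟨x, hxI⟩) heig
    simp only [cfTwist_apply, Pi.smul_apply, CfLip.smul_apply, CfLip.finset_sum_apply, cfPairOp_apply] at h
    rw [CfLip.extend_of_mem _ hxI, ← h]
    exact (sum_attach_attach_eq_sum_prod' A (fun a b => cfWt s (cfGen (a : ℕ) * cfGen (b : ℕ)) x *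
      (F (ξ * cfSigma q (a : ℕ) (b : ℕ))).extend (cfMoeb (cfGen (a : ℕ) * cfGen (b : ℕ)) x))).symm
  have hden : ∀ p : A × A, 0 < cfDenom (cfGen (p.1 : ℕ) * cfGen (p.2 : ℕ)) x := fun p => by
    linarith [(cfDenom_pair_bounds (hA _ p.1.2) (hA _ p.2.2) hxI).1]
  have hptE : ∀ p : A × A, cfMoeb (cfGen (p.1 : ℕ) * cfGen (p.2 : ℕ)) x ∈ cfCantorSet A := fun p =>
    cfMoeb_pair_mem_cfCantorSet A hA p.1.2 p.2.2 hx
  have hnz : ∀ p : A × A, ‖z p‖ = cfWtR A (p.1 : ℕ) (p.2 : ℕ) x *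
      (m * cfHδ A hA h2 (cfMoeb (cfGen (p.1 : ℕ) * cfGen (p.2 : ℕ)) x)) := by
    intro p
    simp only [hz]
    rw [norm_mul, norm_cfWt _ _ (hden p), hre, ← hE _ _ (hptE p)]
    rfl
  -- `Σ ‖z_p‖ = m (T_1 h⊗1)(x) = m h(x)` and `‖Σ z_p‖ = |F_ξ(x)| = m h(x)`
  have hsumnorm : ∑ p : A × A, ‖z p‖ = m * cfHδ A hA h2 x := by
    rw [Finset.sum_congr rfl fun p _ => hnz p]
    have h1 := cfTwistSumR_cfHδ A hA h2 q 1 ξ hxI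
    simp only [cfTwistSumR] at h1
    rw [sum_attach_attach_eq_sum_prod'] at h1
    rw [← h1, Finset.mul_sum]
    exact Finset.sum_congr rfl fun p _ => by ring
  have hnormS : ‖∑ p : A × A, z p‖ = ∑ p : A × A, ‖z p‖ := by
    rw [hS, hsumnorm, norm_mul, hω, one_mul, ← hE ξ x hx, cfAbsFam]
  set p₀ : A × A := (⟨a, ha⟩, ⟨b, hb⟩)
  have key := eq_of_norm_sum_eq_sum_norm Finset.univ z hnormS (Finset.mem_univ p₀)
  rw [hS] at key
  -- unpack
  have hnS : (‖ω * (F ξ).extend x‖ : ℂ) = ((cfAbsFam q F ξ x : ℝ) : ℂ) := by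
    rw [norm_mul, hω, one_mul, cfAbsFam]
  have hz0 : (‖z p₀‖ : ℂ) = cfWt (cfDimension A : ℂ) (cfGen a * cfGen b) x *
      ((cfAbsFam q F (ξ * cfSigma q a b) (cfMoeb (cfGen a * cfGen b) x) : ℝ) : ℂ) := by
    simp only [hz]
    rw [norm_mul, norm_cfWt _ _ (hden p₀), hre, cfWt_ofReal _ _ (hden p₀)]
    push_cast
    rfl
  have hzsplit : z p₀ = cfWt (cfDimension A : ℂ) (cfGen a * cfGen b) x *
      (cfWt (t * Complex.I) (cfGen a * cfGen b) x * (F (ξ * cfSigma q a b)).extend (cfMoeb (cfGen a * cfGen b) x)) := by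
    simp only [hz]
    rw [hs, cfWt_add]
    ring
  rw [hnS, hz0, hzsplit] at key
  have hwσ : cfWt (cfDimension A : ℂ) (cfGen a * cfGen b) x ≠ 0 := Complex.exp_ne_zero _
  apply mul_left_cancel₀ hwσ
  calc cfWt (cfDimension A : ℂ) (cfGen a * cfGen b) x *
        (cfWt (t * Complex.I) (cfGen a * cfGen b) x * (F (ξ * cfSigma q a b)).extend (cfMoeb (cfGen a * cfGen b) x) *
          ((cfAbsFam q F ξ x : ℝ) : ℂ))
      = cfWt (cfDimension A : ℂ) (cfGen a * cfGen b) x *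
          (cfWt (t * Complex.I) (cfGen a * cfGen b) x * (F (ξ * cfSigma q a b)).extend (cfMoeb (cfGen a * cfGen b) x)) *
            ((cfAbsFam q F ξ x : ℝ) : ℂ) := by ring
    _ = cfWt (cfDimension A : ℂ) (cfGen a * cfGen b) x *
          ((cfAbsFam q F (ξ * cfSigma q a b) (cfMoeb (cfGen a * cfGen b) x) : ℝ) : ℂ) * (ω * (F ξ).extend x) := key
    _ = _ := by ring

include h2 in
omit [NeZero q] in
/-- **Phase alignment along twist-word paths:**
`wt_{it,w}(x) · F_{ξσ_w}(pt_w x) · |F_ξ(x)| = ω^{|w|} · F_ξ(x) · |F_{ξσ_w}(pt_w x)|` for `x ∈ E_A`.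
[cite: MageeOhWinter2019, §4.2] -/
theorem cfTwist_eigen_phase_path :
    ∀ (w : List (A × A)) (ξ : SL(2, ZMod q)) {x : ℝ}, x ∈ cfCantorSet A →
      cfPathWtI A t w x * (F (ξ * cfSigmaWord A q w)).extend (cfPathPoint A w x) * ((cfAbsFam q F ξ x : ℝ) : ℂ) =
        ω ^ w.length * (F ξ).extend x * ((cfAbsFam q F (ξ * cfSigmaWord A q w) (cfPathPoint A w x) : ℝ) : ℂ)
  | [], ξ, x, _ => by simp [cfPathWtI, cfPathPoint]
  | p :: w, ξ, x, hx => by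
      have hy : cfMoeb (cfGen ((p.1 : A) : ℕ) * cfGen ((p.2 : A) : ℕ)) x ∈ cfCantorSet A :=
        cfMoeb_pair_mem_cfCantorSet A hA p.1.2 p.2.2 hx
      set y := cfMoeb (cfGen ((p.1 : A) : ℕ) * cfGen ((p.2 : A) : ℕ)) x with hydef
      set η := ξ * cfSigma q ((p.1 : A) : ℕ) ((p.2 : A) : ℕ) with hη
      have hσ : ξ * cfSigmaWord A q (p :: w) = η * cfSigmaWord A q w := by
        rw [show p :: w = [p] ++ w from rfl, cfSigmaWord_append, cfSigmaWord_singleton, ← mul_assoc]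
      have h1 := cfTwist_eigen_phase A hA h2 hω heig hE hx ξ p.1.2 p.2.2
      have IH := cfTwist_eigen_phase_path w η hy
      rw [← hydef, ← hη] at h1
      rw [hσ, List.length_cons, cfPathWtI, cfPathPoint, ← hydef]
      -- `|F_η(y)| ≠ 0`
      have hyI := cfCantorSet_subset_Icc hA hy
      have huy : ((cfAbsFam q F η y : ℝ) : ℂ) ≠ 0 := by
        have h3 : cfAbsFam q F η y ≠ 0 := by
          rw [hE η y hy]; exact (mul_pos hm (cfHδ_pos A hA h2 hyI)).ne'
        exact_mod_cast h3
      apply mul_right_cancel₀ huy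
      calc cfWt (t * Complex.I) (cfGen ((p.1 : A) : ℕ) * cfGen ((p.2 : A) : ℕ)) x * cfPathWtI A t w y *
            (F (η * cfSigmaWord A q w)).extend (cfPathPoint A w y) * ((cfAbsFam q F ξ x : ℝ) : ℂ) * ((cfAbsFam q F η y : ℝ) : ℂ)
          = cfWt (t * Complex.I) (cfGen ((p.1 : A) : ℕ) * cfGen ((p.2 : A) : ℕ)) x * ((cfAbsFam q F ξ x : ℝ) : ℂ) *
              (cfPathWtI A t w y * (F (η * cfSigmaWord A q w)).extend (cfPathPoint A w y) * ((cfAbsFam q F η y : ℝ) : ℂ)) := by ring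
        _ = cfWt (t * Complex.I) (cfGen ((p.1 : A) : ℕ) * cfGen ((p.2 : A) : ℕ)) x * ((cfAbsFam q F ξ x : ℝ) : ℂ) *
              (ω ^ w.length * (F η).extend y * ((cfAbsFam q F (η * cfSigmaWord A q w) (cfPathPoint A w y) : ℝ) : ℂ)) := by rw [IH]
        _ = ω ^ w.length * ((cfAbsFam q F (η * cfSigmaWord A q w) (cfPathPoint A w y) : ℝ) : ℂ) *
              (cfWt (t * Complex.I) (cfGen ((p.1 : A) : ℕ) * cfGen ((p.2 : A) : ℕ)) x * (F η).extend y * ((cfAbsFam q F ξ x : ℝ) : ℂ)) := by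
            ring
        _ = ω ^ w.length * ((cfAbsFam q F (η * cfSigmaWord A q w) (cfPathPoint A w y) : ℝ) : ℂ) *
              (ω * (F ξ).extend x * ((cfAbsFam q F η y : ℝ) : ℂ)) := by rw [h1]
        _ = ω ^ (w.length + 1) * (F ξ).extend x *
              ((cfAbsFam q F (η * cfSigmaWord A q w) (cfPathPoint A w y) : ℝ) : ℂ) * ((cfAbsFam q F η y : ℝ) : ℂ) := by ring

include h2 in
omit [NeZero q] in
/-- **Phases at periodic points of returning paths:** if `x ∈ E_A` is fixed by the path `w`
(`pt_w x = x`) and the path returns to its fibre (`σ_w = 1`), then `wt_{it,w}(x) = ω^{|w|}`.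
[cite: MageeOhWinter2019, §4.2] -/
theorem cfTwist_eigen_phase_periodic {w : List (A × A)} {x : ℝ} (hx : x ∈ cfCantorSet A)
    (hfix : cfPathPoint A w x = x) (hσ : cfSigmaWord A q w = 1) : cfPathWtI A t w x = ω ^ w.length := by
  have h1 := cfTwist_eigen_phase_path A hA h2 hω heig hm hE w 1 hx
  rw [hfix, hσ, mul_one] at h1
  have hxI := cfCantorSet_subset_Icc hA hx
  have hux' : cfAbsFam q F 1 x ≠ 0 := by rw [hE 1 x hx]; exact (mul_pos hm (cfHδ_pos A hA h2 hxI)).ne'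
  have hux : ((cfAbsFam q F 1 x : ℝ) : ℂ) ≠ 0 := by exact_mod_cast hux'
  have hwx : (F 1).extend x ≠ 0 := by
    intro h0; apply hux'; rw [cfAbsFam, h0, norm_zero]
  have h3 := mul_right_cancel₀ hux h1
  exact mul_right_cancel₀ hwx h3

end Align

include h2 in
/-- **Periodic phases to the power `|Γ_q|`:** for ANY path `w` with a periodic point `x ∈ E_A`
(`pt_w x = x`), `wt_{it,w}(x)^{|Γ_q|} = ω^{|w| |Γ_q|}` (the `|Γ_q|`-th power of the path returns to its
fibre). [cite: MageeOhWinter2019, §4.2] -/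
theorem cfTwist_eigen_phase_pow [NeZero q] {t : ℝ} {ω : ℂ} (hω : ‖ω‖ = 1) {F : SL(2, ZMod q) → CfLip}
    (heig : cfTwist A hA q ((cfDimension A : ℂ) + t * Complex.I) F = ω • F)
    {m : ℝ} (hm : 0 < m) (hE : ∀ ξ, ∀ x ∈ cfCantorSet A, cfAbsFam q F ξ x = m * cfHδ A hA h2 x)
    {w : List (A × A)} {x : ℝ} (hx : x ∈ cfCantorSet A) (hfix : cfPathPoint A w x = x) :
    cfPathWtI A t w x ^ Fintype.card (SL(2, ZMod q)) = ω ^ (w.length * Fintype.card (SL(2, ZMod q))) := by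
  set N := Fintype.card (SL(2, ZMod q))
  obtain ⟨hfixN, hwtN⟩ := cfPathWtI_replicate A t w hfix N
  have hσN : cfSigmaWord A q (List.replicate N w).flatten = 1 := by
    rw [cfSigmaWord_replicate_flatten, pow_card_eq_one]
  have h := cfTwist_eigen_phase_periodic A hA h2 hω heig hm hE hx hfixN hσN
  rw [hwtN, List.length_flatten, List.map_replicate, List.sum_replicate, smul_eq_mul, mul_comm] at h
  exact h

/-! ### Path matrices -/

omit hA in
/-- The total matrix of a path: `M_{p :: w} = M_w · (g_{p₁} g_{p₂})` (first pair innermost). [folklore] -/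
def cfPathMat : List (A × A) → Matrix (Fin 2) (Fin 2) ℤ
  | [] => 1
  | p :: w => cfPathMat w * (cfGen ((p.1 : A) : ℕ) * cfGen ((p.2 : A) : ℕ))

/-- **Path data from the total matrix:** positive denominator, `pt_w = M_w ·`, `wt_{it,w} = wt_{it}(M_w)`.
[folklore] -/
theorem cfPathMat_spec (t : ℝ) :
    ∀ (w : List (A × A)) {x : ℝ}, x ∈ Icc (0 : ℝ) 1 →
      0 < cfDenom (cfPathMat A w) x ∧ cfPathPoint A w x = cfMoeb (cfPathMat A w) x ∧
        cfPathWtI A t w x = cfWt (t * Complex.I) (cfPathMat A w) x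
  | [], x, _ => by simp [cfPathMat, cfPathPoint, cfPathWtI, cfDenom, cfMoeb, cfWt]
  | p :: w, x, hx => by
      have hp : 0 < cfDenom (cfGen ((p.1 : A) : ℕ) * cfGen ((p.2 : A) : ℕ)) x := by
        linarith [(cfDenom_pair_bounds (hA _ p.1.2) (hA _ p.2.2) hx).1]
      have hy := cfMoeb_pair_mem (hA _ p.1.2) (hA _ p.2.2) hx
      obtain ⟨hden, hpt, hwt⟩ := cfPathMat_spec t w hy
      refine ⟨?_, ?_, ?_⟩
      · rw [cfPathMat, cfDenom_mul _ _ hp.ne']; exact mul_pos hp hden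
      · rw [cfPathMat, cfPathPoint, cfMoeb_mul _ _ hp.ne' hden.ne', hpt]
      · rw [cfPathMat, cfPathWtI, cfWt_mul _ _ _ hp hden, hwt]

omit hA in
/-- Total matrix of a constant path: `M_{pʲ} = (g_{p₁} g_{p₂})ʲ`. [folklore] -/
theorem cfPathMat_replicate (p : A × A) : ∀ j : ℕ,
    cfPathMat A (List.replicate j p) = (cfGen ((p.1 : A) : ℕ) * cfGen ((p.2 : A) : ℕ)) ^ j
  | 0 => by simp [cfPathMat]
  | j + 1 => by rw [List.replicate_succ, cfPathMat, cfPathMat_replicate p j, ← pow_succ]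

omit hA in
/-- Powers of the weight: `wt_s(M, x)ⁿ = wt_{ns}(M, x)`. [folklore] -/
theorem cfWt_pow (s : ℂ) (M : Matrix (Fin 2) (Fin 2) ℤ) (x : ℝ) (n : ℕ) : cfWt s M x ^ n = cfWt (n * s) M x := by
  rw [cfWt, cfWt, ← Complex.exp_nat_mul]
  congr 1
  ring

/-! ### No unimodular eigenvalues of the congruence operator off `s = δ` -/

include h2 in
/-- **The congruence transfer operator `𝓜_{δ+it,q}` (`t ≠ 0`, `q` with primitive twists) has no
eigenvalue of modulus one** on `SL₂(ℤ/qℤ) → CfLip`: the vector form of the non-lattice property of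
`Γ_A` ([MageeOhWinter2019, §4.1–4.2]; for fixed `q` no expansion is needed). [cite: MageeOhWinter2019, Thm. 4] -/
theorem cfTwist_eigen_eq_zero [NeZero q] {n₀ : ℕ}
    (hprim : ∀ n ≥ n₀, ∀ ξ η : SL(2, ZMod q), ∃ w : List (A × A), w.length = n ∧ ξ * cfSigmaWord A q w = η)
    {t : ℝ} (ht : t ≠ 0) {ω : ℂ} (hω : ‖ω‖ = 1) {F : SL(2, ZMod q) → CfLip}
    (heig : cfTwist A hA q ((cfDimension A : ℂ) + t * Complex.I) F = ω • F) : F = 0 := by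
  obtain ⟨m, hm0, hle, hE⟩ := cfTwist_eigen_maxPrinciple A hA h2 q hprim hω heig
  rcases hm0.eq_or_lt with hm | hm
  · funext ξ
    refine DFunLike.ext _ _ fun x => ?_
    have h1 := hle ξ x x.2
    rw [← hm, zero_mul, cfAbsFam, CfLip.extend_coe] at h1
    exact norm_le_zero_iff.1 h1
  exfalso
  obtain ⟨a, ha, b, hb, hab⟩ := exists_ne_of_two_le_card A h2
  have ha1 : 1 ≤ a := hA a ha
  have hb1 : 1 ≤ b := hA b hb
  -- the enlarged parameters `t' = |Γ| t`, `ω' = ω^{|Γ|}`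
  set N := Fintype.card (SL(2, ZMod q)) with hNdef
  have hN : 0 < N := Fintype.card_pos
  set t' : ℝ := N * t with ht'
  have ht'0 : t' ≠ 0 := mul_ne_zero (by exact_mod_cast hN.ne') ht
  set ω' : ℂ := ω ^ N with hω'
  have hω'1 : ‖ω'‖ = 1 := by rw [hω', norm_pow, hω, one_pow]
  have hNt : ((N : ℂ) * (t * Complex.I)) = t' * Complex.I := by rw [ht']; push_cast; ring
  -- the fixed point of `g_a`: `e = x_a + a`
  set xa : ℝ := cfValue fun _ => a with hxa
  have hxafix : cfMoeb (cfGen a) xa = xa := cfMoeb_cfGen_cfValue ha1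
  have hxaE : xa ∈ cfCantorSet A := ⟨fun _ => a, fun _ => ha, rfl⟩
  have hxaI : xa ∈ Icc (0 : ℝ) 1 := cfCantorSet_subset_Icc hA hxaE
  set e : ℝ := cfDenom (cfGen a) xa with hedef
  have he_eq : e = xa + a := cfDenom_cfGen a xa
  have ha1' : (1 : ℝ) ≤ a := by exact_mod_cast ha1
  have he1 : 1 < e := by rw [he_eq]; linarith [hxaI.1, cfValue_pos (d := fun _ => a) fun _ => ha1]
  have he0 : 0 < e := by linarith
  have hee : e ^ 2 = a * e + 1 := by
    have h1 : xa * (xa + a) = 1 := by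
      have h2' := hxafix
      rw [cfMoeb_cfGen] at h2'
      have h3 : xa + a ≠ 0 := by linarith
      field_simp at h2'
      linarith
    rw [he_eq]; nlinarith [h1]
  -- phase at `x_a` via the pair `(a,a)`: `wt_{it'}(g_a, x_a)² = ω'`
  have hphase_a : cfWt (t' * Complex.I) (cfGen a) xa ^ 2 = ω' := by
    set w1 : List (A × A) := [(⟨a, ha⟩, ⟨a, ha⟩)]
    have hfix1 : cfPathPoint A w1 xa = xa := by
      show cfMoeb (cfGen a * cfGen a) xa = xa
      have hd : cfDenom (cfGen a) xa ≠ 0 := by rw [cfDenom_cfGen]; linarith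
      rw [cfMoeb_mul _ _ hd (by rw [hxafix]; exact hd), hxafix, hxafix]
    have h := cfTwist_eigen_phase_pow A hA h2 q hω heig hm hE hxaE hfix1
    obtain ⟨-, -, hwt⟩ := cfPathMat_spec A hA t w1 hxaI
    rw [hwt, show cfPathMat A w1 = cfGen a * cfGen a by simp [w1, cfPathMat], cfWt_pow, hNt,
      show w1.length * N = N from by simp [w1]] at h
    have hd : 0 < cfDenom (cfGen a) xa := by rw [cfDenom_cfGen]; linarith
    rw [cfWt_mul _ _ _ hd (by rw [hxafix]; exact hd), hxafix, ← sq] at h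
    rw [h, hω']
  -- the periodic points `x_k` of `N_k = g_aᵏ g_b`, `λ_k = denom(N_k, x_k)`
  set xk : ℕ → ℝ := fun k => cfValue (cfPab a b k) with hxk
  have hdk : ∀ k i, 1 ≤ cfPab a b k i := fun k i => hA _ (cfPab_mem ha hb k i)
  have hxkE : ∀ k, xk k ∈ cfCantorSet A := fun k => ⟨cfPab a b k, fun i => cfPab_mem ha hb k i, rfl⟩
  have hxkI : ∀ k, xk k ∈ Icc (0 : ℝ) 1 := fun k => cfValue_mem_Icc (hdk k)
  have hxkfix : ∀ k, cfMoeb (cfNab a b k) (xk k) = xk k := fun k => cfMoeb_cfNab_cfValue ha1 hb1 k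
  set lam : ℕ → ℝ := fun k => cfDenom (cfNab a b k) (xk k) with hlam
  -- phases at odd `k = 2j+1` via the path `(a,b) :: (a,a)ʲ`: `wt_{it'}(N_{2j+1}, x_{2j+1}) = ω'^{j+1}`
  have hphase : ∀ j : ℕ, cfWt (t' * Complex.I) (cfNab a b (2 * j + 1)) (xk (2 * j + 1)) = ω' ^ (j + 1) := by
    intro j
    set wj : List (A × A) := (⟨a, ha⟩, ⟨b, hb⟩) :: List.replicate j (⟨a, ha⟩, ⟨a, ha⟩) with hwj
    have hmat : cfPathMat A wj = cfNab a b (2 * j + 1) := by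
      rw [hwj, cfPathMat, cfPathMat_replicate, cfNab]
      show (cfGen a * cfGen a) ^ j * (cfGen a * cfGen b) = cfGen a ^ (2 * j + 1) * cfGen b
      rw [← sq, ← pow_mul, pow_succ, mul_assoc]
    obtain ⟨-, hpt, hwt⟩ := cfPathMat_spec A hA t wj (hxkI (2 * j + 1))
    have hfix : cfPathPoint A wj (xk (2 * j + 1)) = xk (2 * j + 1) := by rw [hpt, hmat, hxkfix]
    have h := cfTwist_eigen_phase_pow A hA h2 q hω heig hm hE (hxkE (2 * j + 1)) hfix
    rw [hwt, hmat, cfWt_pow, hNt, show wj.length * N = N * (j + 1) by simp [hwj]; ring, pow_mul] at h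
    exact h
  -- `λ_k ∈ [q_k, 2 q_k]`, `q_k = (N_k)₁₁ ≥ 1`
  have hlam_mem : ∀ k, (cfNab a b k 1 1 : ℝ) ≤ lam k ∧ lam k ≤ 2 * (cfNab a b k 1 1 : ℝ) := by
    intro k
    have hmat : cfMat (fun i : Fin (k + 1) => cfPab a b k i) = cfNab a b k := by
      rw [← cfWord_cfPab]
      exact cfWord_congr fun i hi => by rw [cfExt_of_lt _ hi]
    have h1 := cfDenom_cfMat_mem (w := fun i : Fin (k + 1) => cfPab a b k i) (fun i => hdk k i) (hxkI k)
    rw [hmat] at h1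
    have hq : ((cfQ fun i : Fin (k + 1) => cfPab a b k i : ℤ) : ℝ) = (cfNab a b k 1 1 : ℝ) := by
      rw [cfQ_eq, hmat]
    rw [hq] at h1
    exact h1
  have hq1 : ∀ k, (1 : ℝ) ≤ (cfNab a b k 1 1 : ℝ) := by
    intro k
    have hmat : cfMat (fun i : Fin (k + 1) => cfPab a b k i) = cfNab a b k := by
      rw [← cfWord_cfPab]
      exact cfWord_congr fun i hi => by rw [cfExt_of_lt _ hi]
    have h1 : (1 : ℤ) ≤ cfQ fun i : Fin (k + 1) => cfPab a b k i := one_le_cfQ fun i => hdk k i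
    rw [cfQ_eq, hmat] at h1
    exact_mod_cast h1
  have hlam_pos : ∀ k, 0 < lam k := fun k => lt_of_lt_of_le one_pos ((hq1 k).trans (hlam_mem k).1)
  have hquad : ∀ k, lam k * ((cfTab a b k : ℝ) - lam k) = (-1) ^ (k + 1) := by
    intro k
    have h1 := cfDenom_sq_sub_of_fixed (cfNab a b k) (hlam_pos k).ne' (hxkfix k)
    have hdet : ((cfNab a b k 0 0 : ℝ) * cfNab a b k 1 1 - (cfNab a b k 0 1 : ℝ) * cfNab a b k 1 0) = (-1) ^ (k + 1) := by
      have h2' := det_cfNab a b k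
      rw [Matrix.det_fin_two] at h2'
      exact_mod_cast h2'
    rw [hdet] at h1
    have hT : (cfTab a b k : ℝ) = (cfNab a b k 0 0 : ℝ) + cfNab a b k 1 1 := by simp [cfTab]
    rw [hT]
    simp only [hlam] at h1 ⊢
    linarith
  obtain ⟨c, C, hc, hC, hqb⟩ := cf_twoStep_bounds (Q := fun k => (cfNab a b k 1 1 : ℝ)) he0 hee
    (fun k => by simp [cfNab_one_one_add_two])
    (by rw [cfNab_one_one_zero]; exact_mod_cast lt_of_lt_of_le one_pos hb1)
    (by rw [cfNab_one_one_one]; push_cast; positivity)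
  -- `d_j = log λ_{2j+1} - (2j+2) log e` is bounded and `exp(-2it' d_j) = 1`
  set dk : ℕ → ℝ := fun j => Real.log (lam (2 * j + 1)) - (2 * j + 2) * Real.log e with hdk_def
  have hdk_bd : ∀ j, |dk j| ≤ |Real.log c| + |Real.log (2 * C)| + |Real.log e| := by
    intro j
    set k := 2 * j + 1 with hk
    have h1 : c * e ^ k ≤ lam k := (hqb k).1.trans (hlam_mem k).1
    have h2' : lam k ≤ 2 * C * e ^ k := by have := (hqb k).2; have := (hlam_mem k).2; nlinarith
    have hek : 0 < e ^ k := pow_pos he0 k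
    have hl1 := Real.log_le_log (by positivity) h1
    have hl2 := Real.log_le_log (hlam_pos k) h2'
    rw [Real.log_mul hc.ne' hek.ne', Real.log_pow] at hl1
    rw [Real.log_mul (by positivity) hek.ne', Real.log_pow] at hl2
    have hkR : (k : ℝ) = 2 * j + 1 := by rw [hk]; push_cast; ring
    simp only [hdk_def]
    rw [hkR] at hl1 hl2
    have e1 := neg_le_abs (Real.log c)
    have e2 := le_abs_self (Real.log (2 * C))
    have e3 := neg_abs_le (Real.log e)
    have e4 := le_abs_self (Real.log e)
    rw [abs_le]; constructor <;> nlinarith [abs_nonneg (Real.log c), abs_nonneg (Real.log (2 * C))]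
  have hω0 : ω' ≠ 0 := fun h0 => by rw [h0, norm_zero] at hω'1; exact zero_ne_one hω'1
  have hexp : ∀ j, Complex.exp (-(2 * (t' * Complex.I) * (dk j : ℂ))) = 1 := by
    intro j
    have h1 : Complex.exp (-(2 * (t' * Complex.I) * (Real.log (lam (2 * j + 1)) : ℂ))) = ω' ^ (j + 1) := hphase j
    have ha' : Complex.exp (-(2 * (t' * Complex.I) * (Real.log e : ℂ))) ^ 2 = ω' := hphase_a
    have hk : Complex.exp (-(2 * (t' * Complex.I) * (((2 * j + 2) * Real.log e : ℝ) : ℂ))) = ω' ^ (j + 1) := by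
      rw [← ha', ← pow_mul, ← Complex.exp_nat_mul]
      congr 1; push_cast; ring
    have e1 : (-(2 * (t' * Complex.I) * (dk j : ℂ))) =
        (-(2 * (t' * Complex.I) * (Real.log (lam (2 * j + 1)) : ℂ))) -
          (-(2 * (t' * Complex.I) * (((2 * j + 2) * Real.log e : ℝ) : ℂ))) := by
      simp only [hdk_def]; push_cast; ring
    rw [e1, Complex.exp_sub, h1, hk, div_self (pow_ne_zero _ hω0)]
  have hex : ∀ j, ∃ Nj : ℤ, dk j = -(Real.pi * Nj) / t' := by
    intro j
    obtain ⟨Nj, hNj⟩ := Complex.exp_eq_one_iff.1 (hexp j)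
    refine ⟨Nj, ?_⟩
    have e2 : (((-(2 * t' * dk j)) : ℝ) : ℂ) * Complex.I = ((((Nj : ℝ) * (2 * Real.pi)) : ℝ) : ℂ) * Complex.I := by
      push_cast
      calc -(2 * (t' : ℂ) * (dk j : ℂ)) * Complex.I = -(2 * (t' * Complex.I) * (dk j : ℂ)) := by ring
        _ = (Nj : ℂ) * (2 * Real.pi * Complex.I) := hNj
        _ = (Nj : ℂ) * (2 * Real.pi) * Complex.I := by ring
    have e3 := mul_right_cancel₀ Complex.I_ne_zero e2
    have e4 : -(2 * t' * dk j) = (Nj : ℝ) * (2 * Real.pi) := by exact_mod_cast e3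
    field_simp
    linarith
  choose Nj hNj using hex
  set B : ℝ := |Real.log c| + |Real.log (2 * C)| + |Real.log e| with hB
  have hNbd : ∀ j, |(Nj j : ℝ)| ≤ B * |t'| / Real.pi := by
    intro j
    have h1 := hdk_bd j
    rw [hNj j] at h1
    rw [le_div_iff₀ Real.pi_pos]
    have h2' : |(-(Real.pi * Nj j) / t')| = Real.pi * |(Nj j : ℝ)| / |t'| := by
      rw [abs_div, abs_neg, abs_mul, abs_of_pos Real.pi_pos]
    rw [h2', div_le_iff₀ (abs_pos.2 ht'0)] at h1
    linarith
  obtain ⟨j₁, -, j₂, -, hj12, hNeq⟩ : ∃ j₁ ∈ (Set.univ : Set ℕ), ∃ j₂ ∈ (Set.univ : Set ℕ), j₁ ≠ j₂ ∧ Nj j₁ = Nj j₂ := by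
    refine Set.infinite_univ.exists_ne_map_eq_of_mapsTo (f := Nj)
      (t := Set.Icc (-⌈B * |t'| / Real.pi⌉) ⌈B * |t'| / Real.pi⌉) (fun j _ => ?_) (Set.finite_Icc _ _)
    have h1 := abs_le.1 (hNbd j)
    constructor
    · have : (-⌈B * |t'| / Real.pi⌉ : ℝ) ≤ Nj j := by linarith [Int.le_ceil (B * |t'| / Real.pi)]
      exact_mod_cast this
    · have : (Nj j : ℝ) ≤ ⌈B * |t'| / Real.pi⌉ := h1.2.trans (Int.le_ceil _)
      exact_mod_cast this
  have hdeq : dk j₁ = dk j₂ := by rw [hNj j₁, hNj j₂, hNeq]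
  -- `λ_{2j₂+1} = e^{2(j₂-j₁)} λ_{2j₁+1}` for `j₁ < j₂`
  have key : ∀ {j j' : ℕ}, j < j' → dk j = dk j' → lam (2 * j' + 1) = e ^ (2 * j' + 1 - (2 * j + 1)) * lam (2 * j + 1) := by
    intro j j' hjj' hd
    simp only [hdk_def] at hd
    have h1 : Real.log (lam (2 * j' + 1)) = Real.log (lam (2 * j + 1)) + ((2 * j' + 1 - (2 * j + 1) : ℕ) : ℝ) * Real.log e := by
      have : ((2 * j' + 1 - (2 * j + 1) : ℕ) : ℝ) = 2 * j' - 2 * j := by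
        rw [Nat.cast_sub (by omega)]; push_cast; ring
      rw [this]; linarith
    calc lam (2 * j' + 1) = Real.exp (Real.log (lam (2 * j' + 1))) := (Real.exp_log (hlam_pos _)).symm
      _ = Real.exp (Real.log (lam (2 * j + 1)) + ((2 * j' + 1 - (2 * j + 1) : ℕ) : ℝ) * Real.log e) := by rw [h1]
      _ = e ^ (2 * j' + 1 - (2 * j + 1)) * lam (2 * j + 1) := by
          rw [Real.exp_add, Real.exp_log (hlam_pos _), ← Real.log_pow, Real.exp_log (pow_pos he0 _)]; ring
  have hTrec : ∀ k, (cfTab a b (k + 2) : ℝ) = a * (cfTab a b (k + 1) : ℝ) + (cfTab a b k : ℝ) := by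
    intro k; simp [cfTab_add_two]
  have hT0 : (cfTab a b 0 : ℝ) = b := by simp [cfTab_zero]
  have hT1 : (cfTab a b 1 : ℝ) = a * b + 2 := by simp [cfTab_one]
  rcases lt_or_gt_of_ne hj12 with hlt | hlt
  · have hrel := key hlt hdeq
    have hrel' : lam ((2 * j₁ + 1) + (2 * j₂ + 1 - (2 * j₁ + 1))) = e ^ (2 * j₂ + 1 - (2 * j₁ + 1)) * lam (2 * j₁ + 1) := by
      rw [show (2 * j₁ + 1) + (2 * j₂ + 1 - (2 * j₁ + 1)) = 2 * j₂ + 1 by omega]; exact hrel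
    exact hab (cf_nonlattice_core (T := fun k => (cfTab a b k : ℝ)) (lam := lam) he1 hee hT0 hT1 hTrec hquad
      (by omega) hrel')
  · have hrel := key hlt hdeq.symm
    have hrel' : lam ((2 * j₂ + 1) + (2 * j₁ + 1 - (2 * j₂ + 1))) = e ^ (2 * j₁ + 1 - (2 * j₂ + 1)) * lam (2 * j₂ + 1) := by
      rw [show (2 * j₂ + 1) + (2 * j₁ + 1 - (2 * j₂ + 1)) = 2 * j₁ + 1 by omega]; exact hrel
    exact hab (cf_nonlattice_core (T := fun k => (cfTab a b k : ℝ)) (lam := lam) he1 hee hT0 hT1 hTrec hquad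
      (by omega) hrel')

end Phase

end Literature.NumberTheory.Sieve
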